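import Summits.QuantumFields.YangMills.Theorems.BalabanUVNodesN22W1FadingMemoryOfCouplingRadii

/-!
# BalabanUVNodes ∕ node N22 = NE9 — THE PHASE TOWER: a NON-TERMLESS model witness (A6) for the coupling-analytic road at node N22
# (J31's «(2.38) on the young-coupling margin» with AGE-GROWING radii; module `…N22W1FadingMemoryOfCouplingRadii` ★ fires on it non-trivially)

Cell `pub-ymgap`, HUMAN RULING D-0062 (Track A) ∕ D-0149, WIDTH SEAT `pub-ymgap-dag-n22-w1` (harness re-seat g3) on node n22 = NE9; `--kind proof
--supports stmt-QuantumFields-20544 --as helper` (K3⁷ `SpineGivenEndpointR13SepCoPH`), COUNT-NEUTRAL.  THEOREMS ONLY (0 `def`, 0 `sorry`, standard axioms);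
imports this seat's g2 module `…Theorems.BalabanUVNodesN22W1FadingMemoryOfCouplingRadii` (p606932) only — through it dag-n22-c's J31 (p605695) and g0 Road-1 knit,
dag-n22-e's `YMDAG.N22.ne9_of_moduli_le`, node00-def-W1's OBJECT `Node00.HistoryTermsOfRecord` (`W1.ClusterStep ∕ ClusterTower ∕ functionalOn`, `box`), RR-1's `U3Letters₁₁`.

WHY.  Director-ym's A6 rule (№189): a knit whose antecedent is not shown inhabited is «A6-UNCHECKED», and a degenerate inhabitant is the next weakest thing (cf. FLAG
№7 «junk-inhabited»).  On node N22's coupling-analytic road EVERY rider in the tree is TERMLESS ∕ EMPTY and says so (J31 `coordHolo_termlessStep`, J31b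
`coordHoloRel_termlessStep`, g2 `coordHoloRadii_termlessTower` ∕ `ne9_and_fadingMemory_termlessTower`, dag-n22-w2 (C) `…WindowSoftTwoPointAtSlotsInhabited`, dag-n22-w5
`analyticH_termlessStep`): `H ≡ 0`, so (2.38), its differenced form and the margin datum hold with any amplitude and radii, and `NE9` holds because the functional reads
no coupling at all.  THIS MODULE types a NON-TERMLESS model on which the same theorems fire NON-TRIVIALLY — the PHASE TOWER: at step `k` ONE term per polymer,
  `H(Z; g₀,…,g_k; φ) = A·e^{−2}·e^{−R d_{k+1}(Z)} · exp( i · Σ_{i ≤ k} g_i · ω^{k+1−i} ∕ ϱ )`,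
of EXACT modulus `A e^{−2} e^{−R d(Z)}` on real couplings, whose SENSITIVITY to `g_i` is EXACTLY `A e^{−2} e^{−R d(Z)}·ω^{k+1−i}∕ϱ` (genuine dependence on EVERY young
coupling, fading geometrically with its AGE `k+1−i`), and which extends holomorphically in `g_i` to the strip `|Im z| < 2ρ`, `ρ = ϱ·ω^{−(k+1−i)}`, bounded by
`A e^{−R d(Z)}` there (`|e^{izf}| = e^{−f·Im z} ≤ e²` as `f·ρ = 1`): J31's MARGIN DATUM with g2's GEOMETRIC radius table ON THE NOSE.  Hence W1's `YoungLipschitz` slot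
FAILS here for every table vanishing at a coordinate (the slot has content), J31's slots `Bound238` ∕ `YoungLipschitz (4A∕ρ)` hold BY NAME, and g2's ★
`ne9_and_fadingMemory_functionalOn_of_coordHoloRadii` FIRES: `NE9 ∧ FadingMemory` for `W1.functionalOn S p emb` with the genuinely geometric moduli `c·4A·ω^{n−i}∕ϱ` on a
tower that reads every coupling.  The model is characterised by its ACTIVITY FORMULA (hypothesis `hS`); §5 EXHIBITS a realisation (index type `𝐃_{k+1}`, `idx Z = {Z}`).

WHAT (all [folklore]: elementary complex analysis + by-name composition).  §1 phase factor (`‖e^{ix}‖ = 1`, `‖e^{izf}‖ = e^{−f Im z} ≤ e^{rf}` on `|Im z| ≤ r`,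
one-coordinate update of the phase sum).  §2 ONE STEP under `hS` (any `P`, `𝔸`, `M`, `k`): `norm_H_phaseStep`, `H_ne_zero_phaseStep`, `H_update_phaseStep`, ★
`coordHolo_phaseStep` (J31's margin datum on `]0, γ]^{k+1}`, radii `ϱ·(ω^{k+1−i})⁻¹`, amplitude `A`), `bound238_phaseStep` ∕ `youngLipschitz_phaseStep` (J31 BY NAME),
`hasDerivAt_H_coord_phaseStep` ∕ `norm_deriv_H_coord_phaseStep` (the sensitivity), `exists_update_H_ne_phaseStep`, `not_youngLipschitz_of_zero_at_phaseStep`,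
`localizedH_phaseStep`; §2b `analyticH_phaseStep` (the configuration slot, trivially: the model is CONFIGURATION-CONSTANT — declared).  §3 THE TOWER on the `K`-th
torus: `coordHoloRadii_phaseTower` (g2 ★'s `hH` verbatim, `ρ n i = ϱ·(ω^{n−i})⁻¹`), ★★ `ne9_and_fadingMemory_phaseTower` (g2 ★ FIRES; Road-1 numerals displayed as in g2),
`ne9_letterModuli_phaseTower` (g2's K3⁷-shaped `ℓ.moduli` face, phases at rate `ℓ.ω`).  §4 `roadOneNumerals_inhabited`.  §5 `exists_phaseTower` (one term per polymer,
any torus) and ★★ `exists_nonTermless_ne9_and_fadingMemory` (PACKAGED A6: under Road-1's numerals a tower with one term per polymer, activities of modulus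
`A e^{−2} e^{−R d(Z)}` that CHANGE when any single young coupling moves inside `]0, γ]`, carrying node N22's shape `NE9 ∧ FadingMemory` with the geometric table).

HONEST FRAMING.  A MODEL tower, NOT NODE 00's objects: nothing of the record (N10's Lemmas 1–3, NODE A's towers ∕ readings, def-W1's `emb`) is claimed to meet anything;
the activities are CONFIGURATION-CONSTANT (declared; those slots are N10's ∕ NODE A's, not node N22's); a model-level inhabitant books NO discharge.  Count-neutral A6
helper; N22 NOT discharged (typed 28∕28 · discharged 5∕27 UNCHANGED — the chair's single count line is the only count); K3⁷ OPEN, NOT claimed; NE9 ∕ `FadingMemory` NOT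
IN PRINT for d = 4; one finite four-torus programme at fixed ε — R4 closes the CONDITIONAL rung `BalabanLadder.UV` only; NOT infinite volume ∕ OS on ℝ⁴ ∕ mass gap ∕ Clay.
References (TYPES only): [I] = [Balaban1987RG1] CMP **109** (1987) §1 p. 263 («C^∞ … (or analytic)»), §5 p. 298; [II] = [Balaban1988RG2Cluster] CMP **116** (1988)
(2.9)–(2.14) pp. 14–15, Lemma 3 (2.38) p. 20.
-/

noncomputable section

namespace YMDAG.N22.W1.CouplingRadii.PhaseTower

open Set Metric
open scoped BigOperators
open Literature.MathematicalPhysics.QuantumFieldTheory.Balaban1983to89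
open Literature.MathematicalPhysics.QuantumFieldTheory.Balaban1983to89.T4Continuum (T4Family)
open Literature.MathematicalPhysics.QuantumFieldTheory.Balaban1983to89.T4OutputRate
open Literature.MathematicalPhysics.QuantumFieldTheory.Balaban1983to89.B12TreeDecay (K₀ K₀_pos)
open Literature.MathematicalPhysics.QuantumFieldTheory.Balaban1983to89.Node00
open Literature.MathematicalPhysics.QuantumFieldTheory.Balaban1983to89.Node00.Sect2 (domSys domCount CPair)
open Literature.MathematicalPhysics.QuantumFieldTheory.Balaban1983to89.Node00.W1

/-! ## §1 The phase factor `e^{i z f}` and the one-coordinate update of the phase sum -/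

/-- `‖e^{ix}‖ = 1` for real `x`. [folklore] -/
theorem norm_cexp_I_mul_ofReal (x : ℝ) : ‖Complex.exp (Complex.I * (x : ℂ))‖ = 1 := by
  rw [mul_comm]; exact Complex.norm_exp_ofReal_mul_I x

/-- `‖e^{i z f}‖ = e^{−f·Im z}` for real `f`. [folklore] -/
theorem norm_cexp_I_mul_mul_ofReal (z : ℂ) (f : ℝ) :
    ‖Complex.exp (Complex.I * (z * (f : ℂ)))‖ = Real.exp (-(z.im * f)) := by
  rw [Complex.norm_exp, Complex.I_mul_re, Complex.im_mul_ofReal]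

/-- On the horizontal strip `|Im z| ≤ r`: `‖e^{i z f}‖ ≤ e^{r f}` (`f ≥ 0`). [folklore] -/
theorem norm_cexp_I_mul_mul_ofReal_le {z : ℂ} {f r : ℝ} (hf : 0 ≤ f) (hz : |z.im| ≤ r) :
    ‖Complex.exp (Complex.I * (z * (f : ℂ)))‖ ≤ Real.exp (r * f) := by
  rw [norm_cexp_I_mul_mul_ofReal, Real.exp_le_exp]
  have h1 : -z.im ≤ |z.im| := neg_le_abs z.im
  nlinarith

/-- Moving the coordinate `i` of `g` to `t` in the weighted sum `Σ_j g_j c_j`: reset it to `0`, then add `t·c_i`. [folklore] -/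
theorem sum_update_mul {n : ℕ} (g c : Fin n → ℝ) (i : Fin n) (t : ℝ) :
    ∑ j, Function.update g i t j * c j = ∑ j, Function.update g i 0 j * c j + t * c i := by
  classical
  rw [← Finset.sum_erase_add Finset.univ (fun j => Function.update g i t j * c j) (Finset.mem_univ i),
    ← Finset.sum_erase_add Finset.univ (fun j => Function.update g i 0 j * c j) (Finset.mem_univ i)]
  simp only [Function.update_self, zero_mul, add_zero]
  congr 1
  exact Finset.sum_congr rfl fun j hj => by
    rw [Function.update_of_ne (Finset.ne_of_mem_erase hj), Function.update_of_ne (Finset.ne_of_mem_erase hj)]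

/-- The phase factor under a one-coordinate update: `e^{iΣ_j (g|g_i:=t)_j c_j} = e^{iΣ_j (g|g_i:=0)_j c_j} · e^{i t c_i}`. [folklore] -/
theorem cexp_I_sum_update {n : ℕ} (g c : Fin n → ℝ) (i : Fin n) (t : ℝ) :
    Complex.exp (Complex.I * ((∑ j, Function.update g i t j * c j : ℝ) : ℂ)) =
      Complex.exp (Complex.I * ((∑ j, Function.update g i 0 j * c j : ℝ) : ℂ)) *
        Complex.exp (Complex.I * ((t : ℂ) * (c i : ℂ))) := by
  rw [sum_update_mul, Complex.ofReal_add, Complex.ofReal_mul, mul_add, Complex.exp_add]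

/-! ## §2 One step of the phase tower: exact modulus, the margin datum with geometric radii, J31's slots, non-degeneracy -/

section Step
variable {P : Params} {𝔸 : Type*} {M k : ℕ} (S : ClusterStep P 𝔸 M k) {A R ϱ ω : ℝ}
variable (hS : ∀ (g : Fin (k + 1) → ℝ) (φ : CPair P 𝔸) (Z : (domSys P M (k + 1)).Dom),
  S.H g φ Z = ((A * Real.exp (-2) * Real.exp (-(R * (domSys P M (k + 1)).dj Z)) : ℝ) : ℂ) *
    Complex.exp (Complex.I * ((∑ i : Fin (k + 1), g i * (ω ^ (k + 1 - (i : ℕ)) / ϱ) : ℝ) : ℂ)))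
include hS

/-- **EXACT MODULUS** of the phase activity on real couplings: `‖H(Z; g; φ)‖ = A e^{−2} e^{−R d_{k+1}(Z)}` (`A ≥ 0`) — (2.38)'s shape with equality up to `e^{−2}`;
in particular the step is NOT termless. [folklore] -/
theorem norm_H_phaseStep (hA : 0 ≤ A) (g : Fin (k + 1) → ℝ) (φ : CPair P 𝔸) (Z : (domSys P M (k + 1)).Dom) :
    ‖S.H g φ Z‖ = A * Real.exp (-2) * Real.exp (-(R * (domSys P M (k + 1)).dj Z)) := by
  rw [hS, norm_mul, norm_cexp_I_mul_ofReal, mul_one, Complex.norm_real, Real.norm_eq_abs, abs_of_nonneg (by positivity)]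

/-- The phase activity never vanishes (`A > 0`). [folklore] -/
theorem H_ne_zero_phaseStep (hA : 0 < A) (g : Fin (k + 1) → ℝ) (φ : CPair P 𝔸) (Z : (domSys P M (k + 1)).Dom) : S.H g φ Z ≠ 0 := by
  rw [← norm_pos_iff, norm_H_phaseStep S hS hA.le]; positivity

/-- **FACTORISATION UNDER A COORDINATE UPDATE**: `H(Z; g|g_i := t) = H(Z; g|g_i := 0) · e^{i t ω^{k+1−i}∕ϱ}`. [folklore] -/
theorem H_update_phaseStep (g : Fin (k + 1) → ℝ) (φ : CPair P 𝔸) (Z : (domSys P M (k + 1)).Dom) (i : Fin (k + 1)) (t : ℝ) :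
    S.H (Function.update g i t) φ Z =
      S.H (Function.update g i 0) φ Z * Complex.exp (Complex.I * ((t : ℂ) * ((ω ^ (k + 1 - (i : ℕ)) / ϱ : ℝ) : ℂ))) := by
  have h := cexp_I_sum_update g (fun j : Fin (k + 1) => ω ^ (k + 1 - (j : ℕ)) / ϱ) i t
  beta_reduce at h
  rw [hS, hS, h]
  exact (mul_assoc _ _ _).symm

/-- **★ J31's MARGIN DATUM AT THE PHASE STEP, WITH THE GEOMETRIC RADIUS TABLE ON THE NOSE.**  For every prefix `g`, polymer `Z`, configuration `φ`, coordinate `i`: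
`z ↦ H(Z; g|g_i := 0; φ)·e^{i z ω^{k+1−i}∕ϱ}` is holomorphic on the open strip `O = {|Im z| < 2ρ}`, `ρ = ϱ·(ω^{k+1−i})⁻¹` (which contains the closed `ρ`-discs about
`]0, γ]`), bounded there by `A e^{−R d_{k+1}(Z)}` (`|e^{izf}| = e^{−f Im z} < e²`, `f·ρ = 1`), and restricts to `t ↦ H(Z; g|g_i := t; φ)` — the hypothesis `hH` of J31's
`bound238_box_of_coordHolo` ∕ `youngLipschitz_box_of_coordHolo` with radii `ϱ·(ω^{k+1−i})⁻¹`: g2's growth letter realised with equality (`A ≥ 0`, `ϱ, ω > 0`).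
[cite: Balaban1987RG1, §1 p.263 («(or analytic)» in the coupling); Balaban1988RG2Cluster, Lemma 3 (2.38) p.20] -/
theorem coordHolo_phaseStep (hA : 0 ≤ A) (hϱ : 0 < ϱ) (hω : 0 < ω) (γ : ℝ) (sp : (domSys P M (k + 1)).Dom → Set (CPair P 𝔸)) :
    ∀ g ∈ box γ k, ∀ Z, ∀ φ ∈ sp Z, ∀ i : Fin (k + 1),
      ∃ (Hc : ℂ → ℂ) (O : Set ℂ), DifferentiableOn ℂ Hc O ∧
        (∀ t ∈ Ioc (0 : ℝ) γ, closedBall (t : ℂ) (ϱ * (ω ^ (k + 1 - (i : ℕ)))⁻¹) ⊆ O) ∧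
        (∀ z ∈ O, ‖Hc z‖ ≤ A * Real.exp (-(R * (domSys P M (k + 1)).dj Z))) ∧
        (∀ t ∈ Ioc (0 : ℝ) γ, Hc t = S.H (Function.update g i t) φ Z) := by
  intro g _ Z φ _ i
  set f : ℝ := ω ^ (k + 1 - (i : ℕ)) / ϱ with hf_def
  set ρ : ℝ := ϱ * (ω ^ (k + 1 - (i : ℕ)))⁻¹ with hρ_def
  have hf : 0 ≤ f := by positivity
  have hρ : 0 < ρ := by positivity
  have hfρ : ρ * f = 1 := by rw [hf_def, hρ_def]; field_simp
  refine ⟨fun z => S.H (Function.update g i 0) φ Z * Complex.exp (Complex.I * (z * (f : ℂ))), {z : ℂ | |z.im| < 2 * ρ},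
    ?_, ?_, ?_, ?_⟩
  · exact ((differentiable_const _).mul (((differentiable_id.mul_const _).const_mul _).cexp)).differentiableOn
  · intro t _ z hz
    rw [mem_closedBall, dist_eq_norm] at hz
    have him : |z.im| ≤ ρ := by
      calc |z.im| = |(z - (t : ℂ)).im| := by simp
        _ ≤ ‖z - (t : ℂ)‖ := Complex.abs_im_le_norm _
        _ ≤ ρ := hz
    show |z.im| < 2 * ρ
    linarith
  · intro z hz
    have hexp : ‖Complex.exp (Complex.I * (z * (f : ℂ)))‖ ≤ Real.exp 2 := by
      have h := norm_cexp_I_mul_mul_ofReal_le hf (le_of_lt hz)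
      rwa [show 2 * ρ * f = 2 by rw [mul_assoc, hfρ, mul_one]] at h
    rw [norm_mul, norm_H_phaseStep S hS hA]
    calc _ ≤ A * Real.exp (-2) * Real.exp (-(R * (domSys P M (k + 1)).dj Z)) * Real.exp 2 := mul_le_mul_of_nonneg_left hexp (by positivity)
      _ = A * Real.exp (-(R * (domSys P M (k + 1)).dj Z)) := by rw [Real.exp_neg]; field_simp
  · intro t _
    rw [H_update_phaseStep S hS g φ Z i t]

/-- **J31's slot `Bound238` at the phase step** on the box `]0, γ]^{k+1}`, any space table, amplitude `A`, rate `R` — BY NAME `bound238_box_of_coordHolo` on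
`coordHolo_phaseStep`. [cite: Balaban1988RG2Cluster, Lemma 3 (2.38) p.20] -/
theorem bound238_phaseStep (hA : 0 ≤ A) (hϱ : 0 < ϱ) (hω : 0 < ω) (γ : ℝ) (sp : (domSys P M (k + 1)).Dom → Set (CPair P 𝔸)) :
    S.Bound238 (box γ k) sp A R :=
  bound238_box_of_coordHolo S sp (fun i => ϱ * (ω ^ (k + 1 - (i : ℕ)))⁻¹) (fun _ => by positivity)
    (coordHolo_phaseStep S hS hA hϱ hω γ sp)

/-- **J31's slot `YoungLipschitz` at the phase step** with the CAUCHY TABLE OF THE GEOMETRIC RADII `4A∕(ϱ·(ω^{k+1−i})⁻¹)` (`= 4A·ω^{k+1−i}∕ϱ`) — BY NAME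
`youngLipschitz_box_of_coordHolo` on `coordHolo_phaseStep`. [cite: Balaban1987RG1, §1 p.263; Balaban1988RG2Cluster, (2.38) p.20] -/
theorem youngLipschitz_phaseStep (hA : 0 ≤ A) (hϱ : 0 < ϱ) (hω : 0 < ω) (γ : ℝ) (sp : (domSys P M (k + 1)).Dom → Set (CPair P 𝔸)) :
    S.YoungLipschitz (box γ k) sp (fun i => 4 * A / (ϱ * (ω ^ (k + 1 - (i : ℕ)))⁻¹)) R :=
  youngLipschitz_box_of_coordHolo S sp (fun i => ϱ * (ω ^ (k + 1 - (i : ℕ)))⁻¹) (fun _ => by positivity)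
    (coordHolo_phaseStep S hS hA hϱ hω γ sp)

/-- **THE SENSITIVITY TO THE COUPLING `g_i`**: `t ↦ H(Z; g|g_i := t; φ)` has derivative `H(Z; g|g_i := t; φ) · i·ω^{k+1−i}∕ϱ` at every real `t`. [folklore] -/
theorem hasDerivAt_H_coord_phaseStep (g : Fin (k + 1) → ℝ) (φ : CPair P 𝔸) (Z : (domSys P M (k + 1)).Dom) (i : Fin (k + 1)) (t : ℝ) :
    HasDerivAt (fun s : ℝ => S.H (Function.update g i s) φ Z)
      (S.H (Function.update g i t) φ Z * (Complex.I * ((ω ^ (k + 1 - (i : ℕ)) / ϱ : ℝ) : ℂ))) t := by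
  have hfun : (fun s : ℝ => S.H (Function.update g i s) φ Z) = fun s : ℝ =>
      S.H (Function.update g i 0) φ Z * Complex.exp (Complex.I * ((s : ℂ) * ((ω ^ (k + 1 - (i : ℕ)) / ϱ : ℝ) : ℂ))) :=
    funext fun s => H_update_phaseStep S hS g φ Z i s
  rw [hfun, H_update_phaseStep S hS g φ Z i t]
  have h1 : HasDerivAt (fun s : ℝ => Complex.I * ((s : ℂ) * ((ω ^ (k + 1 - (i : ℕ)) / ϱ : ℝ) : ℂ)))
      (Complex.I * ((ω ^ (k + 1 - (i : ℕ)) / ϱ : ℝ) : ℂ)) t := by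
    simpa using ((HasDerivAt.ofReal_comp (hasDerivAt_id t)).mul_const (((ω ^ (k + 1 - (i : ℕ)) / ϱ : ℝ) : ℂ))).const_mul Complex.I
  have h2 := (h1.cexp).const_mul (S.H (Function.update g i 0) φ Z)
  exact h2.congr_deriv (by ring)

/-- **THE SENSITIVITY HAS MODULUS `A e^{−2} e^{−R d_{k+1}(Z)}·ω^{k+1−i}∕ϱ`** — nonzero for `A > 0`, and decaying geometrically with the AGE `k+1−i` of the coupling
(for `ω < 1`): the profile the growth letter of `…FadingMemoryOfCouplingRadii` encodes through Cauchy. [folklore] -/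
theorem norm_deriv_H_coord_phaseStep (hA : 0 ≤ A) (hϱ : 0 < ϱ) (hω : 0 < ω) (g : Fin (k + 1) → ℝ) (φ : CPair P 𝔸) (Z : (domSys P M (k + 1)).Dom)
    (i : Fin (k + 1)) (t : ℝ) :
    ‖deriv (fun s : ℝ => S.H (Function.update g i s) φ Z) t‖ =
      A * Real.exp (-2) * Real.exp (-(R * (domSys P M (k + 1)).dj Z)) * (ω ^ (k + 1 - (i : ℕ)) / ϱ) := by
  rw [(hasDerivAt_H_coord_phaseStep S hS g φ Z i t).deriv, norm_mul, norm_H_phaseStep S hS hA, norm_mul, Complex.norm_I, one_mul,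
    Complex.norm_real, Real.norm_eq_abs, abs_of_nonneg (by positivity)]

/-- **MOVING ONE YOUNG COUPLING INSIDE `]0, γ]` CHANGES THE ACTIVITY.**  For `g` in the box and any coordinate `i` there is `t ∈ ]0, γ]` with
`H(Z; g|g_i := t; φ) ≠ H(Z; g; φ)` (take `t = g_i − δ`, `δ = min(g_i∕2, π∕f_i)`: the phase turns by `δ f_i ∈ ]0, π]`). [folklore] -/
theorem exists_update_H_ne_phaseStep (hA : 0 < A) (hϱ : 0 < ϱ) (hω : 0 < ω) {γ : ℝ} {g : Fin (k + 1) → ℝ} (hg : g ∈ box γ k) (φ : CPair P 𝔸)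
    (Z : (domSys P M (k + 1)).Dom) (i : Fin (k + 1)) :
    ∃ t ∈ Ioc (0 : ℝ) γ, S.H (Function.update g i t) φ Z ≠ S.H g φ Z := by
  set f : ℝ := ω ^ (k + 1 - (i : ℕ)) / ϱ with hf_def
  have hf : 0 < f := by positivity
  have hgi : 0 < g i ∧ g i ≤ γ := hg i
  set δ : ℝ := min (g i / 2) (Real.pi / f) with hδ_def
  have hδpos : 0 < δ := lt_min (by linarith) (div_pos Real.pi_pos hf)
  have hδle : δ ≤ g i / 2 := min_le_left _ _
  have hδf : δ * f ≤ Real.pi := (le_div_iff₀ hf).1 (min_le_right _ _)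
  refine ⟨g i - δ, ⟨by linarith, by linarith⟩, fun heq => ?_⟩
  have hc : S.H (Function.update g i 0) φ Z ≠ 0 := H_ne_zero_phaseStep S hS hA _ φ Z
  have h1 : S.H g φ Z = S.H (Function.update g i 0) φ Z * Complex.exp (Complex.I * ((g i : ℂ) * (f : ℂ))) := by
    conv_lhs => rw [← Function.update_eq_self i g]
    exact H_update_phaseStep S hS g φ Z i (g i)
  rw [H_update_phaseStep S hS g φ Z i (g i - δ), h1] at heq
  have h2 : Complex.exp (Complex.I * (((g i - δ : ℝ) : ℂ) * (f : ℂ))) = Complex.exp (Complex.I * ((g i : ℂ) * (f : ℂ))) :=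
    mul_left_cancel₀ hc heq
  have h3 : Complex.exp (Complex.I * ((δ : ℂ) * (f : ℂ))) = 1 := by
    rw [show Complex.I * ((δ : ℂ) * (f : ℂ)) = Complex.I * ((g i : ℂ) * (f : ℂ)) - Complex.I * (((g i - δ : ℝ) : ℂ) * (f : ℂ)) by
      push_cast; ring, Complex.exp_sub, h2, div_self (Complex.exp_ne_zero _)]
  obtain ⟨n, hn⟩ := Complex.exp_eq_one_iff.1 h3
  have him := congrArg Complex.im hn
  simp only [Complex.mul_re, Complex.ofReal_re, Complex.ofReal_im, mul_zero, sub_zero, Complex.mul_im,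
    Complex.I_re, Complex.I_im, Complex.intCast_re, Complex.intCast_im, Complex.re_ofNat, Complex.im_ofNat, zero_mul, add_zero,
    mul_one, zero_add] at him
  -- `him : δ * f = ↑n * (2 * π)`; impossible for an integer `n` since `0 < δ f ≤ π`
  have hδfpos : 0 < δ * f := mul_pos hδpos hf
  rcases lt_or_ge 0 n with hn0 | hn0
  · have hn1 : (1 : ℝ) ≤ n := by exact_mod_cast hn0
    nlinarith [Real.pi_pos]
  · have hn1 : (n : ℝ) ≤ 0 := by exact_mod_cast hn0
    nlinarith [Real.pi_pos]

/-- **NO LIPSCHITZ TABLE VANISHING AT A COORDINATE.**  If some configuration lies in some polymer's space table, W1's `YoungLipschitz` slot on `]0, γ]^{k+1}` (`γ > 0`)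
FAILS at the phase step for every table `ℓ` with `ℓ i = 0` at some `i` and every rate — e.g. the zero table (at the termless tower it HOLDS with `ℓ = 0`). [folklore] -/
theorem not_youngLipschitz_of_zero_at_phaseStep (hA : 0 < A) (hϱ : 0 < ϱ) (hω : 0 < ω) {γ : ℝ} (hγ : 0 < γ)
    {sp : (domSys P M (k + 1)).Dom → Set (CPair P 𝔸)} {Z : (domSys P M (k + 1)).Dom} {φ : CPair P 𝔸} (hφ : φ ∈ sp Z)
    {ℓ : Fin (k + 1) → ℝ} {i : Fin (k + 1)} (hℓ : ℓ i = 0) (R' : ℝ) :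
    ¬ S.YoungLipschitz (box γ k) sp ℓ R' := by
  intro hY
  have hg : (fun _ : Fin (k + 1) => γ) ∈ box γ k := fun _ => ⟨hγ, le_rfl⟩
  obtain ⟨t, ht, hne⟩ := exists_update_H_ne_phaseStep S hS hA hϱ hω hg φ Z i
  have hg' : Function.update (fun _ : Fin (k + 1) => γ) i t ∈ box γ k := by
    intro j
    by_cases hj : j = i
    · subst hj; simpa using ht
    · rw [Function.update_of_ne hj]; exact ⟨hγ, le_rfl⟩
  have hsum : ∑ j, ℓ j * |Function.update (fun _ : Fin (k + 1) => γ) i t j - γ| = 0 := by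
    refine Finset.sum_eq_zero fun j _ => ?_
    by_cases hj : j = i
    · subst hj; simp [hℓ]
    · rw [Function.update_of_ne hj]; simp
  have h := hY _ hg' _ hg Z φ hφ
  rw [hsum, mul_zero, norm_le_zero_iff, sub_eq_zero] at h
  exact hne h

/-- W1's slot `LocalizedH` (p.14∕15) holds at the phase step — trivially (configuration-constant; declared). [cite: Balaban1988RG2Cluster, (2.9) p.14 and p.15] -/
theorem localizedH_phaseStep : S.LocalizedH := fun g Z φ ψ _ => by rw [hS, hS]

end Step

/-! ## §2b The configuration slots at the phase step (configuration-CONSTANT model — declared; these slots are N10's ∕ NODE A's, not node N22's) -/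

section Config
variable {P : Params} {𝔸 : Type*} [NormedRing 𝔸] [NormedAlgebra ℂ 𝔸] {M k : ℕ} (S : ClusterStep P 𝔸 M k) {A R ϱ ω : ℝ}
variable (hS : ∀ (g : Fin (k + 1) → ℝ) (φ : CPair P 𝔸) (Z : (domSys P M (k + 1)).Dom),
  S.H g φ Z = ((A * Real.exp (-2) * Real.exp (-(R * (domSys P M (k + 1)).dj Z)) : ℝ) : ℂ) *
    Complex.exp (Complex.I * ((∑ i : Fin (k + 1), g i * (ω ^ (k + 1 - (i : ℕ)) / ϱ) : ℝ) : ℂ)))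
include hS

/-- W1's PRINTED slot `AnalyticH` ([II] p.15) holds at the phase step on ANY tables — trivially: the activity does not read the configuration (declared).
[cite: Balaban1988RG2Cluster, p.15 (analyticity statement)] -/
theorem analyticH_phaseStep (Wk : Set (Fin (k + 1) → ℝ)) (sp : (domSys P M (k + 1)).Dom → Set (CPair P 𝔸)) : S.AnalyticH Wk sp := by
  intro g _ Z
  simp only [hS]
  exact analyticOnNhd_const

end Config

/-! ## §3 The phase TOWER on the `K`-th torus: g2 ★'s margin hypothesis, ★ `NE9 ∧ FadingMemory`, the letter-block face -/

section Tower
variable (F : T4Family) (K : ℕ) {𝔸 : Type*} {M : ℕ} (S : ClusterTower (F.P K) 𝔸 M) {A R ϱ ω : ℝ}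
variable (hS : ∀ (k : ℕ) (g : Fin (k + 1) → ℝ) (φ : CPair (F.P K) 𝔸) (Z : (domSys (F.P K) M (k + 1)).Dom),
  (S k).H g φ Z = ((A * Real.exp (-2) * Real.exp (-(R * (domSys (F.P K) M (k + 1)).dj Z)) : ℝ) : ℂ) *
    Complex.exp (Complex.I * ((∑ i : Fin (k + 1), g i * (ω ^ (k + 1 - (i : ℕ)) / ϱ) : ℝ) : ℂ)))
include hS

/-- **g2 ★'s HYPOTHESIS `hH` AT THE PHASE TOWER, VERBATIM, with the geometric radius table `ρ n i = ϱ·(ω^{n−i})⁻¹`** (g2 ★'s growth hypothesis then holds with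
EQUALITY): at every level `k` the margin datum of `coordHolo_phaseStep`. [cite: Balaban1987RG1, §1 p.263; Balaban1988RG2Cluster, (2.38) p.20] -/
theorem coordHoloRadii_phaseTower (hA : 0 ≤ A) (hϱ : 0 < ϱ) (hω : 0 < ω) (γ : ℝ)
    (sp : (k : ℕ) → (domSys (F.P K) M (k + 1)).Dom → Set (CPair (F.P K) 𝔸)) :
    ∀ k, ∀ g ∈ box γ k, ∀ Z, ∀ φ ∈ sp k Z, ∀ i : Fin (k + 1),
      ∃ (Hc : ℂ → ℂ) (O : Set ℂ), DifferentiableOn ℂ Hc O ∧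
        (∀ t ∈ Ioc (0 : ℝ) γ, closedBall (t : ℂ) ((fun n i : ℕ => ϱ * (ω ^ (n - i))⁻¹) (k + 1) i) ⊆ O) ∧
        (∀ z ∈ O, ‖Hc z‖ ≤ A * Real.exp (-(R * (domSys (F.P K) M (k + 1)).dj Z))) ∧
        (∀ t ∈ Ioc (0 : ℝ) γ, Hc t = (S k).H (Function.update g i t) φ Z) :=
  fun k => coordHolo_phaseStep (S k) (hS k) hA hϱ hω γ (sp k)

open Classical in
/-- **★★ g2's ★ FIRES ON A NON-TERMLESS TOWER.**  For the phase tower on the `K`-th torus, ANY pairing `p`, background type `B`, reading `emb` (space tables `univ`),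
Road 1's numerals (`0 < A`, `0 ≤ r₁`, `κ ≤ r₁`, `r₁ + 2·64·log 162 + 2 ≤ R`, `2A·e^{5r₁+1}·K₀(64,8)·9·64 ≤ 1`), `0 < ϱ`, `0 < ω`: node N22's SHAPE holds for
`W1.functionalOn S p emb` — `NE9 … (Window γ) κ Λ ∧ FadingMemory (c·(4A∕ϱ)) ω Λ`, `Λ n i = c·(4A∕(ϱ·(ω^{n−i})⁻¹)) = c·4A·ω^{n−i}∕ϱ`, `c = 8·e·9·64·K₀(64,8)²` — by
`ne9_and_fadingMemory_functionalOn_of_coordHoloRadii` on `coordHoloRadii_phaseTower`; here the activities READ every young coupling (`norm_deriv_H_coord_phaseStep`,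
`exists_update_H_ne_phaseStep`).  A model tower, NOT NODE 00's. [cite: Balaban1987RG1, §1 p.263 and §5 p.298; Balaban1988RG2Cluster, (2.13) p.14 and (2.38) p.20] -/
theorem ne9_and_fadingMemory_phaseTower (p : RunPairing) {B : Type} (emb : B → CPair (F.P K) 𝔸) {γ κ r₁ : ℝ} (hA : 0 < A)
    (hr₁ : 0 ≤ r₁) (hκ : κ ≤ r₁) (hrate : r₁ + 2 * (64 * Real.log 162) + 2 ≤ R) (hsmall : 2 * A * Real.exp (5 * r₁ + 1) * K₀ 64 8 * 9 * 64 ≤ 1)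
    (hϱ : 0 < ϱ) (hω : 0 < ω) :
    NE9 (functionalOn S p emb) (Window γ) κ (fun n i => 8 * (Real.exp 1 * 9 * 64 * K₀ 64 8 ^ 2) * (4 * A / (ϱ * (ω ^ (n - i))⁻¹))) ∧
      FadingMemory (8 * (Real.exp 1 * 9 * 64 * K₀ 64 8 ^ 2) * (4 * A / ϱ)) ω
        (fun n i => 8 * (Real.exp 1 * 9 * 64 * K₀ 64 8 ^ 2) * (4 * A / (ϱ * (ω ^ (n - i))⁻¹))) :=
  ne9_and_fadingMemory_functionalOn_of_coordHoloRadii F K S p emb (fun _ _ => univ) (fun _ _ _ => mem_univ _) hA hr₁ hκ hrate hsmall hϱ hω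
    (fun n i => ϱ * (ω ^ (n - i))⁻¹) (fun _ _ => mul_pos hϱ (inv_pos.2 (pow_pos hω _))) (fun _ _ _ => le_rfl)
    (coordHoloRadii_phaseTower F K S hS hA.le hϱ hω γ fun _ _ => univ)

end Tower

section LetterFace
variable (F : T4Family) (K : ℕ) {𝔸 : Type*} {M : ℕ} (S : ClusterTower (F.P K) 𝔸 M) (ℓ : U3Letters₁₁) {A R ϱ : ℝ}
variable (hS : ∀ (k : ℕ) (g : Fin (k + 1) → ℝ) (φ : CPair (F.P K) 𝔸) (Z : (domSys (F.P K) M (k + 1)).Dom),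
  (S k).H g φ Z = ((A * Real.exp (-2) * Real.exp (-(R * (domSys (F.P K) M (k + 1)).dj Z)) : ℝ) : ℂ) *
    Complex.exp (Complex.I * ((∑ i : Fin (k + 1), g i * (ℓ.ω ^ (k + 1 - (i : ℕ)) / ϱ) : ℝ) : ℂ)))
include hS

open Classical in
/-- **THE K3⁷-SHAPED FACE AT THE PHASE TOWER TUNED TO A LETTER BLOCK's RATE `ℓ.ω`** (`ℓ : U3Letters₁₁`, `ℓ.moduli k i = ℓ.C₉·ℓ.ω^{k−i}`): with the phases at rate
`ℓ.ω` and `c·(4A∕ϱ) ≤ ℓ.C₉`, `NE9 (W1.functionalOn S p emb) (Window γ) κ ℓ.moduli` — g2's `ne9_functionalOn_letterModuli_of_coordHoloRadii` on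
`coordHoloRadii_phaseTower`.  A model tower, NOT NODE 00's; the block's other letters are not read. [cite: Balaban1987RG1, (1.20)-(1.22) p.264 and §5 p.298] -/
theorem ne9_letterModuli_phaseTower (p : RunPairing) {B : Type} (emb : B → CPair (F.P K) 𝔸) {γ κ r₁ : ℝ} (hA : 0 < A) (hr₁ : 0 ≤ r₁)
    (hκ : κ ≤ r₁) (hrate : r₁ + 2 * (64 * Real.log 162) + 2 ≤ R) (hsmall : 2 * A * Real.exp (5 * r₁ + 1) * K₀ 64 8 * 9 * 64 ≤ 1) (hω : 0 < ℓ.ω)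
    (hϱ : 0 < ϱ) (hC₉ : 8 * (Real.exp 1 * 9 * 64 * K₀ 64 8 ^ 2) * (4 * A / ϱ) ≤ ℓ.C₉) :
    NE9 (functionalOn S p emb) (Window γ) κ ℓ.moduli :=
  ne9_functionalOn_letterModuli_of_coordHoloRadii F K S p emb (fun _ _ => univ) (fun _ _ _ => mem_univ _) hA hr₁ hκ hrate hsmall ℓ hω hϱ
    (fun n i => ϱ * (ℓ.ω ^ (n - i))⁻¹) (fun _ _ => mul_pos hϱ (inv_pos.2 (pow_pos hω _))) (fun _ _ _ => le_rfl) hC₉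
    (coordHoloRadii_phaseTower F K S hS hA.le hϱ hω γ fun _ _ => univ)

end LetterFace

/-! ## §4 Road 1's numerals are jointly satisfiable with a positive amplitude -/

/-- The displayed numerals of §3 are inhabited: `κ = r₁ = 0`, `R = 2·64·log 162 + 2`, `A = (2·e·K₀(64,8)·9·64)⁻¹ > 0` (smallness with equality). [folklore] -/
theorem roadOneNumerals_inhabited :
    ∃ κ r₁ R A : ℝ, 0 < A ∧ 0 ≤ r₁ ∧ κ ≤ r₁ ∧ r₁ + 2 * (64 * Real.log 162) + 2 ≤ R ∧
      2 * A * Real.exp (5 * r₁ + 1) * K₀ 64 8 * 9 * 64 ≤ 1 := by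
  have hK : 0 < K₀ 64 8 := K₀_pos 64 8
  refine ⟨0, 0, 2 * (64 * Real.log 162) + 2, (2 * Real.exp 1 * K₀ 64 8 * 9 * 64)⁻¹, by positivity, le_rfl, le_rfl, by simp, le_of_eq ?_⟩
  rw [mul_zero, zero_add]
  field_simp

/-! ## §5 A realisation of the activity formula (one term per polymer) and the packaged A6 statement -/

section Realisation
variable (P : Params) (𝔸 : Type*) (M : ℕ)

/-- **A PHASE TOWER EXISTS** on any torus `P`, any `𝔸`, any `M`: at every step `k` the `ClusterStep` with index type `𝐃_{k+1}`, `idx Z = {Z}` (EXACTLY ONE multi-index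
localizing at each polymer) and term `T(Z) = A e^{−2} e^{−R d(Z)}·e^{iΣ g_i ω^{k+1−i}∕ϱ}` realises the activity formula of §2–§3. [folklore] -/
theorem exists_phaseTower (A R ϱ ω : ℝ) :
    ∃ S : ClusterTower P 𝔸 M, (∀ k Z, ((S k).idx Z).card = 1) ∧
      ∀ (k : ℕ) (g : Fin (k + 1) → ℝ) (φ : CPair P 𝔸) (Z : (domSys P M (k + 1)).Dom),
        (S k).H g φ Z = ((A * Real.exp (-2) * Real.exp (-(R * (domSys P M (k + 1)).dj Z)) : ℝ) : ℂ) *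
          Complex.exp (Complex.I * ((∑ i : Fin (k + 1), g i * (ω ^ (k + 1 - (i : ℕ)) / ϱ) : ℝ) : ℂ)) := by
  refine ⟨fun k => ⟨(domSys P M (k + 1)).Dom, fun Z => {Z}, fun Z g _ =>
    ((A * Real.exp (-2) * Real.exp (-(R * (domSys P M (k + 1)).dj Z)) : ℝ) : ℂ) *
      Complex.exp (Complex.I * ((∑ i : Fin (k + 1), g i * (ω ^ (k + 1 - (i : ℕ)) / ϱ) : ℝ) : ℂ))⟩,
    fun k Z => Finset.card_singleton Z, fun k g φ Z => ?_⟩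
  show ∑ i ∈ ({Z} : Finset _), _ = _
  rw [Finset.sum_singleton]

end Realisation

section Packaged
variable (F : T4Family) (K : ℕ) (𝔸 : Type*) (M : ℕ)

open Classical in
/-- **★★ PACKAGED A6 — NODE N22's SHAPE ON A TOWER THAT READS EVERY COUPLING.**  Under Road 1's numerals (inhabited: `roadOneNumerals_inhabited`), any pairing,
background type, reading map, `0 < ϱ`, `0 < ω`, any `γ`: THERE IS a cluster tower on the `K`-th torus with (i) EXACTLY ONE multi-index per polymer at every step, (ii)
activities of EXACT modulus `A e^{−2} e^{−R d_{k+1}(Z)}`, (iii) activities that CHANGE when any single young coupling moves inside `]0, γ]`, (iv) node N22's shape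
`NE9 (W1.functionalOn S p emb) (Window γ) κ Λ ∧ FadingMemory (c·(4A∕ϱ)) ω Λ`, `Λ n i = c·(4A∕(ϱ·(ω^{n−i})⁻¹))`.  g2 ★'s antecedent inhabited NON-degenerately; a model
tower, NOT NODE 00's — nothing of the record is claimed. [cite: Balaban1987RG1, §1 p.263 and §5 p.298; Balaban1988RG2Cluster, (2.13) p.14 and (2.38) p.20] -/
theorem exists_nonTermless_ne9_and_fadingMemory (p : RunPairing) {B : Type} (emb : B → CPair (F.P K) 𝔸) {γ κ A R r₁ ϱ ω : ℝ}
    (hA : 0 < A) (hr₁ : 0 ≤ r₁) (hκ : κ ≤ r₁) (hrate : r₁ + 2 * (64 * Real.log 162) + 2 ≤ R)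
    (hsmall : 2 * A * Real.exp (5 * r₁ + 1) * K₀ 64 8 * 9 * 64 ≤ 1) (hϱ : 0 < ϱ) (hω : 0 < ω) :
    ∃ S : ClusterTower (F.P K) 𝔸 M,
      (∀ k Z, ((S k).idx Z).card = 1) ∧
      (∀ (k : ℕ) (g : Fin (k + 1) → ℝ) (φ : CPair (F.P K) 𝔸) (Z : (domSys (F.P K) M (k + 1)).Dom),
        ‖(S k).H g φ Z‖ = A * Real.exp (-2) * Real.exp (-(R * (domSys (F.P K) M (k + 1)).dj Z))) ∧
      (∀ (k : ℕ) (g : Fin (k + 1) → ℝ), g ∈ box γ k → ∀ (φ : CPair (F.P K) 𝔸) (Z : (domSys (F.P K) M (k + 1)).Dom) (i : Fin (k + 1)),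
        ∃ t ∈ Ioc (0 : ℝ) γ, (S k).H (Function.update g i t) φ Z ≠ (S k).H g φ Z) ∧
      (NE9 (functionalOn S p emb) (Window γ) κ (fun n i => 8 * (Real.exp 1 * 9 * 64 * K₀ 64 8 ^ 2) * (4 * A / (ϱ * (ω ^ (n - i))⁻¹))) ∧
        FadingMemory (8 * (Real.exp 1 * 9 * 64 * K₀ 64 8 ^ 2) * (4 * A / ϱ)) ω
          (fun n i => 8 * (Real.exp 1 * 9 * 64 * K₀ 64 8 ^ 2) * (4 * A / (ϱ * (ω ^ (n - i))⁻¹)))) := by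
  obtain ⟨S, hcard, hS⟩ := exists_phaseTower (F.P K) 𝔸 M A R ϱ ω
  exact ⟨S, hcard, fun k => norm_H_phaseStep (S k) (hS k) hA.le,
    fun k g hg φ Z i => exists_update_H_ne_phaseStep (S k) (hS k) hA hϱ hω hg φ Z i,
    ne9_and_fadingMemory_phaseTower F K S hS p emb hA hr₁ hκ hrate hsmall hϱ hω⟩

end Packaged

end YMDAG.N22.W1.CouplingRadii.PhaseTower

end
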